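import Literature.Algebra.Homology.QuasiIsoToHomology
import Mathlib.Algebra.Homology.ShortComplex.ModuleCat
import Mathlib.Algebra.Category.ModuleCat.Abelian
import Mathlib.Algebra.Module.Projective
import Mathlib.LinearAlgebra.Projection
import Mathlib.LinearAlgebra.Basis.VectorSpace
import HarnessLib

/-!
# Splitting a complex of vector spaces: `Cⁿ = Bⁿ ⊕ ι s(Hⁿ) ⊕ Kⁿ` and `d : Kⁿ ≅ Bⁿ⁺¹` (Weibel Thm. 3.6.3, proof)

Layer `Literature/Algebra/Homology` (pure homological algebra over Mathlib; constructions + proved lemmas, 0 named facts, no instances, no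
notation). Over a FIELD `k`, for a cochain complex `C` of `k`-vector spaces, the choices behind «every complex of vector spaces is split»:
`splitSection C n : Hⁿ(C) ⟶ Zⁿ(C)` (a section of the homology projection — vector spaces are projective), `splitCompl C n = Kⁿ` (a
complement of the cycles `Zⁿ = cyclesSubmodule C n ⊆ Cⁿ` — every subspace is a direct summand), `cyclesProjection`,
`splitRetraction C n : Cⁿ ⟶ Zⁿ(C)` (the retraction of `ι` along `Kⁿ`, through `liftCycles`; `iCycles_comp_splitRetraction`),
**`isCompl_boundaries`** (`Cⁿ⁺¹ = Bⁿ⁺¹ ⊕ (ι s Hⁿ⁺¹ ⊕ Kⁿ⁺¹)`) and **`splitComplEquivBoundaries C n : Kⁿ ≃ₗ[k] Bⁿ⁺¹`** along `d`. The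
elementwise exactness at `Zⁿ` / `Hⁿ` (`exists_iCycles_eq_of_d_eq_zero`, `exists_toCycles_eq_of_homologyπ_eq_zero`) is Mathlib's
`cyclesIsKernel` / `homologyIsCokernel`. The sequel `Algebra/Homology/SplitComplexField` builds the generalised inverse of `d` and the
homotopy equivalence `C ≃ₕ (H•(C), 0)`. Library only (cell `pub-hodge-ring2`, count-neutral); proves nothing about any crux, route or
conjecture. Mathlib searched (pin v4.32): `Submodule.exists_isCompl`, `Submodule.projection`, `LinearMap.exists_rightInverse_of_surjective`,
`LinearEquiv.ofBijective`, `liftCycles`, `ShortComplex.exact_of_f_is_kernel` / `exact_of_g_is_cokernel` / `moduleCat_exact_iff` (used).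

## References

* C. A. Weibel, *An introduction to homological algebra* (1994), Thm. 3.6.3 (proof), Ex. 1.4.3. [Weibel1994]
* H. Cartan, S. Eilenberg, *Homological Algebra* (1956), VI.3, Thm. 3.1. [CartanEilenberg1956]
-/

noncomputable section

open CategoryTheory CategoryTheory.Category CategoryTheory.Limits HomologicalComplex

universe u

namespace Literature.Algebra.Homology

variable {k : Type u} [Field k] (C : CochainComplex (ModuleCat.{u} k) ℤ)

/-- Every element killed by `dⁿ` is a cycle. [cite: Weibel1994, Thm. 3.6.3 (proof)] -/
theorem exists_iCycles_eq_of_d_eq_zero (n : ℤ) (x : C.X n) (hx : (C.d n (n + 1)).hom x = 0) :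
    ∃ z : C.cycles n, (C.iCycles n).hom z = x :=
  (ShortComplex.moduleCat_exact_iff (ShortComplex.mk (C.iCycles n) (C.d n (n + 1)) (C.iCycles_d n (n + 1)))).1
    (ShortComplex.exact_of_f_is_kernel _ (C.cyclesIsKernel n (n + 1) (by simp))) x hx

/-- Every cycle with zero homology class is in the image of `toCycles`. [cite: Weibel1994, Thm. 3.6.3 (proof)] -/
theorem exists_toCycles_eq_of_homologyπ_eq_zero (n : ℤ) (z : C.cycles (n + 1)) (hz : (C.homologyπ (n + 1)).hom z = 0) :
    ∃ y : C.X n, (C.toCycles n (n + 1)).hom y = z :=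
  (ShortComplex.moduleCat_exact_iff
      (ShortComplex.mk (C.toCycles n (n + 1)) (C.homologyπ (n + 1)) (C.toCycles_comp_homologyπ n (n + 1)))).1
    (ShortComplex.exact_of_g_is_cokernel _ (C.homologyIsCokernel n (n + 1) (by simp))) z hz

/-- A section of the homology projection exists (vector spaces are projective). [cite: Weibel1994, Thm. 3.6.3 (proof)] -/
theorem exists_section_homologyπ (n : ℤ) : ∃ s : C.homology n ⟶ C.cycles n, s ≫ C.homologyπ n = 𝟙 _ := by
  have hsurj : Function.Surjective (C.homologyπ n).hom := (ModuleCat.epi_iff_surjective _).mp inferInstance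
  obtain ⟨g, hg⟩ := (C.homologyπ n).hom.exists_rightInverse_of_surjective (LinearMap.range_eq_top.mpr hsurj)
  exact ⟨ModuleCat.ofHom g, by ext x; exact LinearMap.congr_fun hg x⟩

/-- **A chosen section `s : Hⁿ(C) ⟶ Zⁿ(C)` of the homology projection.** [cite: Weibel1994, Thm. 3.6.3 (proof)] -/
def splitSection (n : ℤ) : C.homology n ⟶ C.cycles n := (exists_section_homologyπ C n).choose

/-- `s ≫ π = 𝟙`. [cite: Weibel1994, Thm. 3.6.3 (proof)] -/
@[simp] theorem splitSection_comp_homologyπ (n : ℤ) : splitSection C n ≫ C.homologyπ n = 𝟙 _ :=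
  (exists_section_homologyπ C n).choose_spec

/-- `π (s x) = x`. [cite: Weibel1994, Thm. 3.6.3 (proof)] -/
@[simp] theorem homologyπ_splitSection_apply (n : ℤ) (x : C.homology n) :
    (C.homologyπ n).hom ((splitSection C n).hom x) = x := by
  rw [← LinearMap.comp_apply, ← ModuleCat.hom_comp, splitSection_comp_homologyπ, ModuleCat.hom_id, LinearMap.id_apply]

/-- The cycles `Zⁿ = ι(Zⁿ(C)) ⊆ Cⁿ` as a subspace. [cite: Weibel1994, Thm. 3.6.3 (proof)] -/
def cyclesSubmodule (n : ℤ) : Submodule k (C.X n) := LinearMap.range (C.iCycles n).hom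

/-- **A chosen complement `Kⁿ` of the cycles in `Cⁿ`.** [cite: Weibel1994, Thm. 3.6.3 (proof)] -/
def splitCompl (n : ℤ) : Submodule k (C.X n) := ((cyclesSubmodule C n).exists_isCompl).choose

/-- `Cⁿ = Zⁿ ⊕ Kⁿ`. [cite: Weibel1994, Thm. 3.6.3 (proof)] -/
theorem isCompl_cycles_splitCompl (n : ℤ) : IsCompl (cyclesSubmodule C n) (splitCompl C n) :=
  ((cyclesSubmodule C n).exists_isCompl).choose_spec

/-- The projection `Cⁿ → Cⁿ` onto the cycles along `Kⁿ`. [cite: Weibel1994, Thm. 3.6.3 (proof)] -/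
def cyclesProjection (n : ℤ) : C.X n →ₗ[k] C.X n :=
  (cyclesSubmodule C n).projection (splitCompl C n) (isCompl_cycles_splitCompl C n)

/-- `d (pZ x) = 0`. [cite: Weibel1994, Thm. 3.6.3 (proof)] -/
theorem d_cyclesProjection_apply (n : ℤ) (x : C.X n) : (C.d n (n + 1)).hom (cyclesProjection C n x) = 0 := by
  obtain ⟨z, hz⟩ : cyclesProjection C n x ∈ cyclesSubmodule C n := Submodule.projection_apply_mem _ x
  rw [← hz, ← LinearMap.comp_apply, ← ModuleCat.hom_comp, iCycles_d, ModuleCat.hom_zero, LinearMap.zero_apply]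

/-- **The retraction `r : Cⁿ ⟶ Zⁿ(C)`** of `ι` along `Kⁿ` (`liftCycles` of the projection). [cite: Weibel1994, Thm. 3.6.3 (proof)] -/
def splitRetraction (n : ℤ) : C.X n ⟶ C.cycles n :=
  C.liftCycles (ModuleCat.ofHom (cyclesProjection C n)) (n + 1) (by simp) (by ext x; exact d_cyclesProjection_apply C n x)

/-- `r ≫ ι` is the projection onto the cycles. [cite: Weibel1994, Thm. 3.6.3 (proof)] -/
@[simp] theorem splitRetraction_comp_iCycles (n : ℤ) :
    splitRetraction C n ≫ C.iCycles n = ModuleCat.ofHom (cyclesProjection C n) :=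
  C.liftCycles_i _ _ _ _

/-- `ι (r x) = pZ x`. [cite: Weibel1994, Thm. 3.6.3 (proof)] -/
theorem iCycles_splitRetraction_apply (n : ℤ) (x : C.X n) :
    (C.iCycles n).hom ((splitRetraction C n).hom x) = cyclesProjection C n x := by
  rw [← LinearMap.comp_apply, ← ModuleCat.hom_comp, splitRetraction_comp_iCycles, ModuleCat.hom_ofHom]

/-- `ι ≫ r = 𝟙`. [cite: Weibel1994, Thm. 3.6.3 (proof)] -/
theorem iCycles_comp_splitRetraction (n : ℤ) : C.iCycles n ≫ splitRetraction C n = 𝟙 _ := by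
  rw [← cancel_mono (C.iCycles n), assoc, splitRetraction_comp_iCycles, id_comp]
  ext z
  exact Submodule.projection_apply_of_mem_left _ (LinearMap.mem_range_self _ z)

/-- `ι z - ι s π z` is a boundary, for every cycle `z`. [cite: Weibel1994, Thm. 3.6.3 (proof)] -/
theorem iCycles_sub_mem_range_d (n : ℤ) (z : C.cycles (n + 1)) :
    (C.iCycles (n + 1)).hom z - (C.iCycles (n + 1)).hom ((splitSection C (n + 1)).hom ((C.homologyπ (n + 1)).hom z)) ∈
      LinearMap.range (C.d n (n + 1)).hom := by
  obtain ⟨y, hy⟩ := exists_toCycles_eq_of_homologyπ_eq_zero C n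
    (z - (splitSection C (n + 1)).hom ((C.homologyπ (n + 1)).hom z)) (by rw [map_sub, homologyπ_splitSection_apply, sub_self])
  refine ⟨y, ?_⟩
  rw [← map_sub, ← hy, ← LinearMap.comp_apply, ← ModuleCat.hom_comp, toCycles_i]

/-- **`Cⁿ⁺¹ = Bⁿ⁺¹ ⊕ (ι s Hⁿ⁺¹ ⊕ Kⁿ⁺¹)`.** [cite: Weibel1994, Thm. 3.6.3 (proof)] -/
theorem isCompl_boundaries (n : ℤ) :
    IsCompl (LinearMap.range (C.d n (n + 1)).hom)
      (LinearMap.range ((C.iCycles (n + 1)).hom ∘ₗ (splitSection C (n + 1)).hom) ⊔ splitCompl C (n + 1)) := by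
  refine IsCompl.of_eq (eq_bot_iff.2 fun x hx => ?_) (eq_top_iff.2 fun x _ => ?_)
  · obtain ⟨⟨y, rfl⟩, hx⟩ := Submodule.mem_inf.1 hx
    obtain ⟨h, ⟨η, rfl⟩, w, hw, hsum⟩ := Submodule.mem_sup.1 hx
    rw [LinearMap.comp_apply] at hsum
    -- `w = d y - ι s η ∈ Zⁿ⁺¹ ⊓ Kⁿ⁺¹ = 0`
    have hdy : (C.d n (n + 1)).hom y = (C.iCycles (n + 1)).hom ((C.toCycles n (n + 1)).hom y) := by
      rw [← LinearMap.comp_apply, ← ModuleCat.hom_comp, toCycles_i]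
    have hwZ : w ∈ cyclesSubmodule C (n + 1) := by
      have hw' : w = (C.iCycles (n + 1)).hom ((C.toCycles n (n + 1)).hom y - (splitSection C (n + 1)).hom η) := by
        rw [map_sub, ← hdy, ← hsum, add_sub_cancel_left]
      exact ⟨_, hw'.symm⟩
    have hw0 : w = 0 := (Submodule.disjoint_def.1 (isCompl_cycles_splitCompl C (n + 1)).disjoint) w hwZ hw
    -- hence `toCycles y = s η`; applying `π` gives `η = 0`
    rw [hw0, add_zero] at hsum
    have hys : (C.toCycles n (n + 1)).hom y = (splitSection C (n + 1)).hom η :=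
      (ModuleCat.mono_iff_injective _).mp inferInstance (hdy.symm.trans hsum.symm)
    have hη : η = 0 := by
      rw [← homologyπ_splitSection_apply C (n + 1) η, ← hys, ← LinearMap.comp_apply, ← ModuleCat.hom_comp,
        toCycles_comp_homologyπ, ModuleCat.hom_zero, LinearMap.zero_apply]
    rw [Submodule.mem_bot, ← hsum, hη, map_zero, map_zero]
  · -- `x = (ι z - ι s π z) + (ι s π z + (x - pZ x))` with `ι z = pZ x`
    obtain ⟨z, hz⟩ : cyclesProjection C (n + 1) x ∈ cyclesSubmodule C (n + 1) := Submodule.projection_apply_mem _ x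
    have hK := Submodule.sub_projection_mem (isCompl_cycles_splitCompl C (n + 1)) x
    have hx : x = ((C.iCycles (n + 1)).hom z -
        (C.iCycles (n + 1)).hom ((splitSection C (n + 1)).hom ((C.homologyπ (n + 1)).hom z))) +
        ((C.iCycles (n + 1)).hom ((splitSection C (n + 1)).hom ((C.homologyπ (n + 1)).hom z)) +
          (x - cyclesProjection C (n + 1) x)) := by
      rw [hz]; abel
    rw [hx]
    exact Submodule.add_mem_sup (iCycles_sub_mem_range_d C n z)
      (Submodule.add_mem_sup (LinearMap.mem_range_self _ _) hK)

/-- `d` restricted to `Kⁿ`, with values in `Bⁿ⁺¹`. [cite: Weibel1994, Thm. 3.6.3 (proof)] -/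
def dRestrict (n : ℤ) : splitCompl C n →ₗ[k] LinearMap.range (C.d n (n + 1)).hom :=
  LinearMap.codRestrict _ ((C.d n (n + 1)).hom ∘ₗ (splitCompl C n).subtype) fun x =>
    LinearMap.mem_range_self _ (x : C.X n)

/-- `(d|_K x) = d x` (`rfl`). [cite: Weibel1994, Thm. 3.6.3 (proof)] -/
@[simp] theorem dRestrict_apply_coe (n : ℤ) (x : splitCompl C n) : (dRestrict C n x : C.X (n + 1)) = (C.d n (n + 1)).hom x := rfl

/-- **`d|_K : Kⁿ → Bⁿ⁺¹` is bijective** (its kernel is `Zⁿ ⊓ Kⁿ = 0`; `d(Cⁿ) = d(Zⁿ + Kⁿ) = d(Kⁿ)`). [cite: Weibel1994, Thm. 3.6.3 (proof)] -/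
theorem dRestrict_bijective (n : ℤ) : Function.Bijective (dRestrict C n) := by
  constructor
  · rw [injective_iff_map_eq_zero]
    intro x hx
    have hx' : (C.d n (n + 1)).hom x = 0 := by rw [← dRestrict_apply_coe, hx]; rfl
    obtain ⟨z, hz⟩ := exists_iCycles_eq_of_d_eq_zero C n x hx'
    have hxZ : (x : C.X n) ∈ cyclesSubmodule C n := ⟨z, hz⟩
    exact Subtype.ext ((Submodule.disjoint_def.1 (isCompl_cycles_splitCompl C n).disjoint) x hxZ x.2)
  · rintro ⟨b, y, rfl⟩
    refine ⟨⟨y - cyclesProjection C n y, Submodule.sub_projection_mem (isCompl_cycles_splitCompl C n) y⟩, Subtype.ext ?_⟩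
    rw [dRestrict_apply_coe, Submodule.coe_mk, map_sub, d_cyclesProjection_apply, sub_zero]

/-- **`Kⁿ ≅ Bⁿ⁺¹`** along `d`. [cite: Weibel1994, Thm. 3.6.3 (proof)] -/
def splitComplEquivBoundaries (n : ℤ) : splitCompl C n ≃ₗ[k] LinearMap.range (C.d n (n + 1)).hom :=
  LinearEquiv.ofBijective (dRestrict C n) (dRestrict_bijective C n)

/-- `(e x) = d x` (`rfl`). [cite: Weibel1994, Thm. 3.6.3 (proof)] -/
@[simp] theorem splitComplEquivBoundaries_apply_coe (n : ℤ) (x : splitCompl C n) :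
    (splitComplEquivBoundaries C n x : C.X (n + 1)) = (C.d n (n + 1)).hom x := rfl

end Literature.Algebra.Homology

end
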